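import Mathlib
import Summits.Ventures.HodgeRepro.Tier4.Line1.PrincipalDiscrete
import Summits.Ventures.HodgeRepro.Tier4.Line1.AddFundamentalDomainOfCompact
import Summits.Ventures.HodgeRepro.Tier4.Line1.CocompactReduction

/-!
# Tier4/Line1/AdelicBlichfeldt — rung C4 of the R-c cut: Blichfeldt's lemma for `k⁴ ⊆ 𝔸_k⁴`, modulo C3

Blind re-derivation cell `pub-hodge-repro`, Tier 4 (README §9–§10), seat t4-L1-p5 (prover, LINE L1, gen 0).
Given (C3) «`𝔸_k/k` is compact» (displayed hypothesis; `Tier4/Line1/AdeleCocompactAssembly.lean` derives it from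
C1 + C2), the principal lattice `k⁴ ⊆ 𝔸_k⁴` has a fundamental domain `F` of finite Haar measure (the additive twin of
`FundamentalDomainOfCompact`), and Mathlib's Blichfeldt lemma `exists_pair_mem_lattice_not_disjoint_vadd` gives: every
measurable `S` with `μ S > μ F` contains two points whose difference is a NON-ZERO rational vector.  This is the
adelic Minkowski input (M1) of the Mostow–Tamagawa induction (CENSUS v4, V11) — what it still lacks for R-c is the
modulus rung C5.

Nothing here says anything about the status of the Hodge conjecture for CM abelian varieties, which is NOT proved
(HC_CM is NOT proved by anyone in this repository).
-/

set_option autoImplicit false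

noncomputable section

namespace Summit.Ventures.HodgeRepro.Tier4.Line1

open NumberField MeasureTheory Topology Set
open scoped ENNReal Pointwise

section Blichfeldt

variable (k : Type) [Field k] [NumberField k]

/-- the principal lattice `k⁴ ⊆ 𝔸_k⁴` (coordinatewise principal adeles) is discrete -/
theorem principalLattice_discrete :
    DiscreteTopology (AddSubgroup.pi Set.univ
      (fun _ : Fin 4 => AdeleRing.principalSubgroup (𝓞 k) k)) := by
  haveI := principalSubgroup_discrete k
  refine DiscreteTopology.of_continuous_injective
    (f := fun γ : AddSubgroup.pi Set.univ (fun _ : Fin 4 => AdeleRing.principalSubgroup (𝓞 k) k) =>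
      fun i : Fin 4 => (⟨(γ : Fin 4 → AdeleRing (𝓞 k) k) i, γ.2 i (Set.mem_univ i)⟩ :
        AdeleRing.principalSubgroup (𝓞 k) k)) ?_ ?_
  · exact continuous_pi fun i =>
      Continuous.subtype_mk ((continuous_apply i).comp continuous_subtype_val) _
  · intro γ δ h
    apply Subtype.ext
    funext i
    have := congrArg (fun f => (f i : AdeleRing (𝓞 k) k)) h
    exact this

/-- the principal lattice `k⁴ ⊆ 𝔸_k⁴` is countable (it injects into `k⁴`) -/
theorem principalLattice_countable :
    Countable (AddSubgroup.pi Set.univ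
      (fun _ : Fin 4 => AdeleRing.principalSubgroup (𝓞 k) k)) := by
  haveI : Countable k := countable_numberField (k := k)
  classical
  let φ : AddSubgroup.pi Set.univ (fun _ : Fin 4 => AdeleRing.principalSubgroup (𝓞 k) k) → (Fin 4 → k) :=
    fun γ i => Classical.choose (γ.2 i (Set.mem_univ i))
  have hφ : Function.Injective φ := by
    intro γ δ h
    apply Subtype.ext
    funext i
    have hγ := Classical.choose_spec (γ.2 i (Set.mem_univ i))
    have hδ := Classical.choose_spec (δ.2 i (Set.mem_univ i))
    have := congrArg (fun f => f i) h
    simp only [φ] at this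
    rw [← hγ, ← hδ, this]
  exact hφ.countable

/-- (C4 modulo C3) **Adelic Blichfeldt**: for every Haar measure `μ` on `𝔸_k⁴` there is a finite constant `c`
(the measure of a fundamental domain of `k⁴`) such that every measurable `S` with `μ S > c` contains two points
differing by a non-zero rational vector. -/
theorem exists_ne_zero_rational_mem_sub_of
    (h3 : ∃ C : Set (AdeleRing (𝓞 k) k), IsCompact C ∧
      ∀ x : AdeleRing (𝓞 k) k, ∃ a : k, x - algebraMap k (AdeleRing (𝓞 k) k) a ∈ C)
    [MeasurableSpace (Fin 4 → AdeleRing (𝓞 k) k)] [BorelSpace (Fin 4 → AdeleRing (𝓞 k) k)]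
    (μ : Measure (Fin 4 → AdeleRing (𝓞 k) k)) [μ.IsAddHaarMeasure] :
    ∃ c : ℝ≥0∞, c < ∞ ∧ ∀ S : Set (Fin 4 → AdeleRing (𝓞 k) k), MeasurableSet S → c < μ S →
      ∃ x : Fin 4 → k, x ≠ 0 ∧ ∃ s ∈ S, ∃ t ∈ S,
        s - t = fun i => algebraMap k (AdeleRing (𝓞 k) k) (x i) := by
  classical
  obtain ⟨C, hC, hcov⟩ := h3
  haveI := t2Space_adeleRing k
  let L : AddSubgroup (Fin 4 → AdeleRing (𝓞 k) k) :=
    AddSubgroup.pi Set.univ (fun _ : Fin 4 => AdeleRing.principalSubgroup (𝓞 k) k)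
  haveI : DiscreteTopology L := principalLattice_discrete k
  haveI : Countable L := principalLattice_countable k
  have hC4 : IsCompact (Set.pi Set.univ (fun _ : Fin 4 => C)) := isCompact_univ_pi fun _ => hC
  have hcov4 : ∀ x : Fin 4 → AdeleRing (𝓞 k) k, ∃ γ : L, ∃ c ∈ Set.pi Set.univ (fun _ : Fin 4 => C),
      x = (γ : Fin 4 → AdeleRing (𝓞 k) k) + c := by
    intro x
    choose a ha using fun i => hcov (x i)
    refine ⟨⟨fun i => algebraMap k (AdeleRing (𝓞 k) k) (a i), fun i _ => ⟨a i, rfl⟩⟩,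
      fun i => x i - algebraMap k (AdeleRing (𝓞 k) k) (a i), fun i _ => ha i, ?_⟩
    funext i
    simp
  obtain ⟨F, hF, hFc⟩ :=
    exists_isAddFundamentalDomain_isCompact_closure_of_isCompact L μ hC4 hcov4
  refine ⟨μ F, ?_, ?_⟩
  · exact lt_of_le_of_lt (measure_mono subset_closure) hFc.measure_lt_top
  · intro S hS hμ
    obtain ⟨γ₁, γ₂, hne, hdisj⟩ :=
      exists_pair_mem_lattice_not_disjoint_vadd hF hS.nullMeasurableSet hμ
    rw [Set.not_disjoint_iff] at hdisj
    obtain ⟨z, hz₁, hz₂⟩ := hdisj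
    rw [Set.mem_vadd_set] at hz₁ hz₂
    obtain ⟨s, hs, hzs⟩ := hz₁
    obtain ⟨t, ht, hzt⟩ := hz₂
    -- `s - t = γ₂ - γ₁`
    have hdiff : s - t = (γ₂ : Fin 4 → AdeleRing (𝓞 k) k) - γ₁ := by
      have h1 : (γ₁ : Fin 4 → AdeleRing (𝓞 k) k) + s = z := hzs
      have h2 : (γ₂ : Fin 4 → AdeleRing (𝓞 k) k) + t = z := hzt
      rw [← h2] at h1
      -- h1 : γ₁ + s = γ₂ + t
      calc s - t = ((γ₁ : Fin 4 → AdeleRing (𝓞 k) k) + s) - ((γ₁ : Fin 4 → AdeleRing (𝓞 k) k) + t) := by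
            abel
        _ = ((γ₂ : Fin 4 → AdeleRing (𝓞 k) k) + t) - ((γ₁ : Fin 4 → AdeleRing (𝓞 k) k) + t) := by
            rw [h1]
        _ = (γ₂ : Fin 4 → AdeleRing (𝓞 k) k) - γ₁ := by abel
    have hmem : ∀ i, ((γ₂ : Fin 4 → AdeleRing (𝓞 k) k) - γ₁) i ∈
        AdeleRing.principalSubgroup (𝓞 k) k := fun i => (L.sub_mem γ₂.2 γ₁.2) i (Set.mem_univ i)
    choose x hx using fun i => hmem i
    refine ⟨x, ?_, s, hs, t, ht, ?_⟩
    · intro hx0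
      apply hne
      apply Subtype.ext
      have : (γ₂ : Fin 4 → AdeleRing (𝓞 k) k) - γ₁ = 0 := by
        funext i
        rw [← hx i, congrFun hx0 i, Pi.zero_apply, map_zero, Pi.zero_apply]
      exact (sub_eq_zero.1 this).symm
    · rw [hdiff]
      funext i
      exact (hx i).symm

end Blichfeldt

end Summit.Ventures.HodgeRepro.Tier4.Line1

end
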